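import Summits.ValiantsHypothesis.ValiantsHypothesis.Theorems.KPlusLogSqLawTropicalGradedWalkDefs

/-!
# Route «KPlusLogSqLaw» — GRW-lite (all-`m` `K = 4` family): the reduced chain, definitions

HONEST FRAMING.  Definitions-only file (D-0009) of the helper chain `--supports` the crux
`Summit.ValiantsHypothesis.ValiantsHypothesis.Theses.KPlusLogSqLaw.TropicalB` (item `stmt-ValiantsHypothesis-19771`, route `KPlusLogSqLaw`;
cell `pub-symmetroid`, seat val-sym-trop-p3 g15, 2026-08-29), on top of `…TropicalGradedWalkDefs.lean`.  Bookkeeping functions of the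
chain enumeration only; nothing is proved here and nothing bears on `TropicalB`, `WeakLifting`, `MatrixDescartes` or `VP ≠ VNP`.

CONTENT.  The REDUCED GRW-lite chain = the states of the phases `1 ≤ w ≤ m − 1` of the design of `…TropicalGradedWalkDefs` in slope
order WITHOUT the excursion pair `(w,1,0), (w,1,1)` (dropping a consecutive pair keeps the sign alternation) and without the phases `0`
and `m`: per phase `D(w,0,0), D(w,2,0), X(w,2,1), D(w,3,0), …, X(w,w−1,1), T(w,w,0), …, T(w,w,w)` (`lenP w = 3w − 2` states, `3` for
`w = 1`).  `nxt` = successor, `seqR k` = `k`-th state from `D(1,0,0)`, `ValidR` = the state invariant, `posR` / `offP` / `idxR` = position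
in the phase / number of states before the phase / rank.  The companion file `…GradedWalkChain.lean` proves that `seqR` enumerates a dominant
sign-alternating chain of `offP (n+1) = (3n² − n + 4)/2` terms.
-/

set_option linter.dupNamespace false
set_option autoImplicit false

namespace Summit.ValiantsHypothesis.ValiantsHypothesis.Theorems.LacunarySymmetroidMatrixDescartes.TropicalCensus

namespace GradedWalk

/-! ### the reduced chain -/

/-- successor of a state `(w, u, t)` in the reduced chain. -/
def nxt (s : ℕ × ℕ × ℕ) : ℕ × ℕ × ℕ :=
  if s.2.1 < s.1 then
    (if s.2.2 = 0 then
      (if s.2.1 = 0 then (if 2 < s.1 then (s.1, 2, 0) else (s.1, s.1, 0)) else (s.1, s.2.1, 1))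
     else (if s.2.1 + 1 < s.1 then (s.1, s.2.1 + 1, 0) else (s.1, s.1, 0)))
  else (if s.2.2 < s.1 then (s.1, s.1, s.2.2 + 1) else (s.1 + 1, 0, 0))

/-- the `k`-th state of the reduced chain (starting at `D(1,0,0)`). -/
def seqR (k : ℕ) : ℕ × ℕ × ℕ := nxt^[k] (1, 0, 0)

/-- the states of the reduced chain: `D(w,u,0)` with `u = 0` or `2 ≤ u < w`; `X(w,u,1)` with `2 ≤ u < w`; `T(w,w,t)` with `t ≤ w`; `w ≥ 1`. -/
def ValidR (s : ℕ × ℕ × ℕ) : Prop :=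
  1 ≤ s.1 ∧ ((s.2.1 < s.1 ∧ s.2.2 = 0 ∧ (s.2.1 = 0 ∨ 2 ≤ s.2.1)) ∨ (2 ≤ s.2.1 ∧ s.2.1 < s.1 ∧ s.2.2 = 1) ∨
    (s.2.1 = s.1 ∧ s.2.2 ≤ s.1))

/-- length of phase `w ≥ 1`: `3w − 2` (`3` for `w = 1`). -/
def lenP (w : ℕ) : ℕ := 2 * (w - 2) + (w + 2)

/-- number of states in the phases `1, …, w − 1`. -/
def offP : ℕ → ℕ
  | 0 => 0
  | w + 1 => offP w + (if w = 0 then 0 else lenP w)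

/-- position of a state inside its phase. -/
def posR (s : ℕ × ℕ × ℕ) : ℕ :=
  if s.2.1 < s.1 then (if s.2.2 = 0 then (if s.2.1 = 0 then 0 else 2 * s.2.1 - 3) else 2 * s.2.1 - 2)
  else 2 * (s.1 - 2) + 1 + s.2.2

/-- rank of a state in the reduced chain. -/
def idxR (s : ℕ × ℕ × ℕ) : ℕ := offP s.1 + posR s

end GradedWalk

end Summit.ValiantsHypothesis.ValiantsHypothesis.Theorems.LacunarySymmetroidMatrixDescartes.TropicalCensus
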